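import Summits.ABC.IUTFork.Cor312ThetaSidePerImageK
import Summits.ABC.IUTFork.Cor312ProvKIdeles
import Summits.ABC.IUTFork.Thm311Real3
import Literature.IUT.LogVolume.GenuineLogThetaPoint
import HarnessLib

/-!
# [IUTchIII] Corollary 3.12, reading (P) — the per-image Θ-READ binder `hΘP` AT A GENUINE Θ-VOLUME DATUM: the binder shapes of the
# K-level (P)-line certificates (`abc_of_S_perImage_v6K`, p441497) as THEOREMS

PROOF-ONLY companion (D-0012; no definitions, no `Prop` facts) of `Cor312ThetaSidePerImageK` (abc-iut cell, R2 S-chain team, seat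
abc-iut-s2-p9 gen 3, TARGET #2 per-image half). TAKES NO SIDE on [IUTchIII] Cor. 3.12, on (U)/(P), or on any author. The datum-level
corollaries of `processionNormalized_imageChoice_settingPrVolSharp_pilotDataOfK_le_genuine` (every global possible image of the Θ-pilot
object at abc-iut-c312-7's sharp real setting over `K` has procession-normalised log-volume `≤ −|log(Θ)|_(P)` of the datum, for realising
Θ-ideles; in fact `= −deĝ̲_lgp(P_Θ)`, slack `≥ ((l+5)/4)·log π`):

* `imageChoice_settingPrVolSharp_pilotDataOfK_le_datum` — at `T : Cor22.ThetaVolumeDatumAt P l`, ANY realising Θ-ideles (the shape of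
  abc-iut-s2-p6's `negLogTheta_settingPrVolSharp_pilotDataOfK_le_datum` on the (U) line, p447368);
* **`imageChoice_settingPrVolSharp_pilotDataOfK_chosen_le_datum`** — LITERALLY the binder `hΘP` of abc-iut-w6-d110's `abc_of_S_perImage_v6K`
  (p441497: CHOSEN realising ideles of abc-iut-C-cert-3 p434704, `LatticeSituation.ofShells` form with the column binders) minus its unused
  admissibility guards: that certificate's `hΘP` is `fun P _ l _ _ _ _ _ _ T => imageChoice_settingPrVolSharp_pilotDataOfK_chosen_le_datum T
  (M P l T) (archPk P l T) … (qData P l T)` — READ 1 ↦ 0 on the (P) line (explicit 3 = S · PIN · READ ↦ 2 = S · PIN).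

[cite: Mochizuki2012, IUTchIII Cor. 3.12 p. 173–174; proof Step (x) p. 181] [cite: Mochizuki2012, IUTchIV Thm. 1.10 p. 23, Step (vii) p. 30]
[cite: Mochizuki2012, IUTchI Ex. 3.2 (iv) p. 71] [cite: DupuyHilado2025, §3.3, §3.4, Thm. 3.10.1, §4.10–4.12] [claim: Mochizuki2012, status: disputed]
for every quoted construction. HONEST FRAMING: removes a READING hypothesis from CONDITIONAL certificates «abc ⇐ S + pins + hΘP»; asserts nothing
about [IUTchIII] Cor. 3.12, about S or the pins, or about abc; no side taken; typed ≠ proved; instantiated ≠ endorsed.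
-/

noncomputable section

open Set Function NumberField IsDedekindDomain
open scoped Pointwise

namespace Summit.ABC.IUTFork.Thm311.Real

open Cor312 Cor312Vol Cor312Prov Literature.IUT.LogThetaLattice Literature.IUT.LogVolume Literature.IUT.HodgeTheaters
  Literature.NumberTheory.NumberFields

/-! ## §3. At a genuine Θ-volume DATUM (binder shapes of the (P)-line certificates) -/

section Datum

/-- **`hΘP` PER DATUM, AS A THEOREM, for every realising choice of Θ-ideles** (the shape of abc-iut-s2-p6's
`negLogTheta_settingPrVolSharp_pilotDataOfK_le_datum` on the (U) line): for every genuine Θ-volume datum `T` at a point `P` and prime `l`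
(abc-iut-S2's `Cor22.ThetaVolumeDatumAt`), every context of abc-iut-c312-7's sharp real setting over `T.K` at `pilotDataOfK T.D T.K`, every
q-idele `tq` (non-zero, units off `S`), EVERY realising Θ-idele `t` (`ht0`, `hT`) and every global possible image `U`: its procession-normalised
total log-volume is `≤ T.negLogThetaPerImage`. HONEST SCOPE: a comparison of OUR two typings at the datum; nothing about [IUTchIII] Cor. 3.12 itself.
[cite: Mochizuki2012, IUTchIII Cor. 3.12 p. 173–174; proof Step (x) p. 181] [cite: Mochizuki2012, IUTchIV Thm. 1.10 Steps (v)–(viii) p. 27–30]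
[claim: Mochizuki2012, status: disputed] -/
theorem imageChoice_settingPrVolSharp_pilotDataOfK_le_datum
    {P : Literature.NumberTheory.DiophantineGeometry.GenEll.NFPoint} {l : ℕ} (T : Cor22.ThetaVolumeDatumAt P l) :
    letI := T.instFieldF; letI := T.instNumberFieldF; letI := T.instAlgebraF; letI := T.instFieldK;
    letI := T.instNumberFieldK; letI := T.instAlgebraK; letI := T.instFieldFbar; letI := T.instAlgebraFbar;
    letI := T.instAlgebraKFbar; letI := T.instIsElliptic;
    ∀ (M : Type) [Field M] [NumberField M]
      (archPk : ∀ (j : (thetaIndex (pilotDataOfK T.D T.K)).Label) (vQ : (thetaIndex (pilotDataOfK T.D T.K)).VQ),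
        Set ((logShellsDH (pilotDataOfK T.D T.K) (analyticLogv T.K)).Packet j vQ))
      (archSub : ∀ (j : (thetaIndex (pilotDataOfK T.D T.K)).Label) (v : (thetaIndex (pilotDataOfK T.D T.K)).V),
        Set ((logShellsDH (pilotDataOfK T.D T.K) (analyticLogv T.K)).Packet j ((thetaIndex (pilotDataOfK T.D T.K)).over v)))
      (Ψ : ℤ → ∀ v : (thetaIndex (pilotDataOfK T.D T.K)).V, v ∈ (thetaIndex (pilotDataOfK T.D T.K)).Vbad →
        Set ((logShellsDH (pilotDataOfK T.D T.K) (analyticLogv T.K)).StarPacket v))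
      (act : ℤ → ∀ v : (thetaIndex (pilotDataOfK T.D T.K)).V, v ∈ (thetaIndex (pilotDataOfK T.D T.K)).Vbad →
        (logShellsDH (pilotDataOfK T.D T.K) (analyticLogv T.K)).StarPacket v →
          Module.End ℚ ((logShellsDH (pilotDataOfK T.D T.K) (analyticLogv T.K)).StarPacket v))
      (Mmod : ℤ → ∀ j : (thetaIndex (pilotDataOfK T.D T.K)).LabelStar,
        Set ((logShellsDH (pilotDataOfK T.D T.K) (analyticLogv T.K)).GlobalPacket j.1))
      (region : ℤ → ∀ j : (thetaIndex (pilotDataOfK T.D T.K)).LabelStar, FinDivisor M →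
        ∀ vQ : (thetaIndex (pilotDataOfK T.D T.K)).VQ, Set ((logShellsDH (pilotDataOfK T.D T.K) (analyticLogv T.K)).Packet j.1 vQ))
      (n : ℤ) {HT : Type} {LogLink : HT → HT → Type} {IsFull : ∀ {s t : HT}, LogLink s t → Prop}
      (lat : LGPGaussianLogThetaLattice LogLink IsFull)
      {Frd : Type} {IsoF : Frd → Frd → Type} {Ob : Frd → Type} {realify : Frd → Frd} {Strip : Type}
      {IsoS : Strip → Strip → Type}
      {Mv : ∀ v : (thetaIndex (pilotDataOfK T.D T.K)).V, v ∈ (thetaIndex (pilotDataOfK T.D T.K)).Vbad → Type}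
      [∀ v h, Monoid (Mv v h)]
      (sig : GlobalLGPFrobenioidSignature (thetaIndex (pilotDataOfK T.D T.K)).lstar (thetaIndex (pilotDataOfK T.D T.K)).V
        (· ∈ (thetaIndex (pilotDataOfK T.D T.K)).Vbad) Frd IsoF Ob realify Strip IsoS Mv)
      (split : SplittingMonoids Mv) {ObΔ : Type}
      {N : ∀ v : (thetaIndex (pilotDataOfK T.D T.K)).V, v ∈ (thetaIndex (pilotDataOfK T.D T.K)).Vbad → Type} [∀ v h, Monoid (N v h)]
      (qData : QPilotData ObΔ N)
      (tq : ∀ (pp : Nat.Primes) (x : (thetaIndex (pilotDataOfK T.D T.K)).Fibre (.inr pp)),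
        haveI : Fact (pp : ℕ).Prime := ⟨pp.2⟩; kOf (pilotDataOfK T.D T.K) pp.1 x)
      (t : ∀ (pp : Nat.Primes) (_ : Fin (pilotDataOfK T.D T.K).lstar) (x : (thetaIndex (pilotDataOfK T.D T.K)).Fibre (.inr pp)),
        haveI : Fact (pp : ℕ).Prime := ⟨pp.2⟩; kOf (pilotDataOfK T.D T.K) pp.1 x)
      (htq0 : ∀ pp x, tq pp x ≠ 0)
      (htq1 : ∀ (pp : Nat.Primes) (x : (thetaIndex (pilotDataOfK T.D T.K)).Fibre (.inr pp)),
        haveI : Fact (pp : ℕ).Prime := ⟨pp.2⟩; placeOf (pilotDataOfK T.D T.K) pp.1 x ∉ (pilotDataOfK T.D T.K).S → ‖tq pp x‖ = 1),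
      (∀ pp i x, t pp i x ≠ 0) →
      (∀ (pp : Nat.Primes) (i : Fin (pilotDataOfK T.D T.K).lstar) (x : (thetaIndex (pilotDataOfK T.D T.K)).Fibre (.inr pp)),
        haveI : Fact (pp : ℕ).Prime := ⟨pp.2⟩
        Real.log ‖t pp i x‖ = -((pilotDataOfK T.D T.K).thetaPilot i (placeOf (pilotDataOfK T.D T.K) pp.1 x)) *
          logNorm T.K (placeOf (pilotDataOfK T.D T.K) pp.1 x) / localDegree T.K (placeOf (pilotDataOfK T.D T.K) pp.1 x)) →
      ∀ U : ImageChoice (settingPrVolSharp (pilotDataOfK T.D T.K) (logvAnalytic_analyticLogv (F := T.K)) M archPk archSub Ψ act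
          Mmod region n lat sig split qData tq t htq0 htq1),
        processionNormalized (fun i : Fin (thetaIndex (pilotDataOfK T.D T.K)).lstar =>
            ∑ᶠ vQ : (thetaIndex (pilotDataOfK T.D T.K)).VQ,
              ((situationPrVol (pilotDataOfK T.D T.K) (logvAnalytic_analyticLogv (F := T.K)) M archPk archSub Ψ act Mmod region).D
                n).logvol (Setting.labelSucc i) vQ (U.1 (i, vQ))) ≤
          T.negLogThetaPerImage := by
  intro M _ _ archPk archSub Ψ act Mmod region n HT LogLink IsFull lat Frd IsoF Ob realify Strip IsoS Mv _ sig split ObΔ N _ qData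
    tq t htq0 htq1 ht0 hT U
  letI := T.instFieldF; letI := T.instNumberFieldF; letI := T.instAlgebraF; letI := T.instFieldK
  letI := T.instNumberFieldK; letI := T.instAlgebraK; letI := T.instFieldFbar; letI := T.instAlgebraFbar
  letI := T.instAlgebraKFbar; letI := T.instIsElliptic
  exact processionNormalized_imageChoice_settingPrVolSharp_pilotDataOfK_le_genuine T.D M archPk archSub Ψ act Mmod region n lat
    sig split qData tq t htq0 htq1 ht0 hT T.isVolumeInputOf U

/-- **`hΘP` of `abc_of_S_perImage_v6K` (p441497), PER DATUM, AS A THEOREM — literally its binder** (CHOSEN realising ideles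
`(exists_realising_thetaIdeles_pilotDataOfK T.D).choose` / `(exists_realising_qIdeles_pilotDataOfK T.D).choose` of abc-iut-C-cert-3, p434704;
`LatticeSituation.ofShells` form with the column binders `frobAdm … thetaDiv`; the admissibility guards `P ∈ UP`, `l` prime `≥ 5`, `AdmitsCore`,
`CondP2/P5/P6` of that certificate are simply not used): v6K-(P)'s `hΘP` is
`fun P _ l _ _ _ _ _ _ T => imageChoice_settingPrVolSharp_pilotDataOfK_chosen_le_datum T (M P l T) (archPk P l T) … (qData P l T)`.
The realising property is the `choose_spec` of the chosen Θ-ideles. HONEST SCOPE as above; it removes the READ binder of a CONDITIONAL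
certificate «abc ⇐ S + pins + hΘP» and asserts nothing about S, the pins, or abc. [cite: Mochizuki2012, IUTchI Ex. 3.2 (iv) p. 71;
IUTchIII Cor. 3.12 p. 173–174] [cite: DupuyHilado2025, §3.4] [claim: Mochizuki2012, status: disputed] -/
theorem imageChoice_settingPrVolSharp_pilotDataOfK_chosen_le_datum
    {P : Literature.NumberTheory.DiophantineGeometry.GenEll.NFPoint} {l : ℕ} (T : Cor22.ThetaVolumeDatumAt P l) :
    letI := T.instFieldF; letI := T.instNumberFieldF; letI := T.instAlgebraF; letI := T.instFieldK;
    letI := T.instNumberFieldK; letI := T.instAlgebraK; letI := T.instFieldFbar; letI := T.instAlgebraFbar;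
    letI := T.instAlgebraKFbar; letI := T.instIsElliptic;
    ∀ (M : Type) [Field M] [NumberField M]
      (archPk : ∀ (j : (thetaIndex (pilotDataOfK T.D T.K)).Label) (vQ : (thetaIndex (pilotDataOfK T.D T.K)).VQ),
        Set ((logShellsDH (pilotDataOfK T.D T.K) (analyticLogv T.K)).Packet j vQ))
      (archSub : ∀ (j : (thetaIndex (pilotDataOfK T.D T.K)).Label) (v : (thetaIndex (pilotDataOfK T.D T.K)).V),
        Set ((logShellsDH (pilotDataOfK T.D T.K) (analyticLogv T.K)).Packet j ((thetaIndex (pilotDataOfK T.D T.K)).over v)))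
      (Ψ : ℤ → ∀ v : (thetaIndex (pilotDataOfK T.D T.K)).V, v ∈ (thetaIndex (pilotDataOfK T.D T.K)).Vbad →
        Set ((logShellsDH (pilotDataOfK T.D T.K) (analyticLogv T.K)).StarPacket v))
      (act : ℤ → ∀ v : (thetaIndex (pilotDataOfK T.D T.K)).V, v ∈ (thetaIndex (pilotDataOfK T.D T.K)).Vbad →
        (logShellsDH (pilotDataOfK T.D T.K) (analyticLogv T.K)).StarPacket v →
          Module.End ℚ ((logShellsDH (pilotDataOfK T.D T.K) (analyticLogv T.K)).StarPacket v))
      (Mmod : ℤ → ∀ j : (thetaIndex (pilotDataOfK T.D T.K)).LabelStar,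
        Set ((logShellsDH (pilotDataOfK T.D T.K) (analyticLogv T.K)).GlobalPacket j.1))
      (region : ℤ → ∀ j : (thetaIndex (pilotDataOfK T.D T.K)).LabelStar, FinDivisor M →
        ∀ vQ : (thetaIndex (pilotDataOfK T.D T.K)).VQ, Set ((logShellsDH (pilotDataOfK T.D T.K) (analyticLogv T.K)).Packet j.1 vQ))
      (frobAdm : ℤ → ℤ → ∀ (j : (thetaIndex (pilotDataOfK T.D T.K)).Label) (vQ : (thetaIndex (pilotDataOfK T.D T.K)).VQ),
        Set ((logShellsDH (pilotDataOfK T.D T.K) (analyticLogv T.K)).Packet j vQ) → Prop)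
      (frobLogvol : ℤ → ℤ → ∀ (j : (thetaIndex (pilotDataOfK T.D T.K)).Label) (vQ : (thetaIndex (pilotDataOfK T.D T.K)).VQ),
        Set ((logShellsDH (pilotDataOfK T.D T.K) (analyticLogv T.K)).Packet j vQ) → ℝ)
      (frobMmod : ℤ → ℤ → ∀ j : (thetaIndex (pilotDataOfK T.D T.K)).LabelStar,
        Set ((logShellsDH (pilotDataOfK T.D T.K) (analyticLogv T.K)).GlobalPacket j.1))
      (unitImage : ℤ → ℤ → ℕ → ∀ (j : (thetaIndex (pilotDataOfK T.D T.K)).Label) (vQ : (thetaIndex (pilotDataOfK T.D T.K)).VQ),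
        Set ((logShellsDH (pilotDataOfK T.D T.K) (analyticLogv T.K)).Packet j vQ))
      (ballImage : ℤ → ℤ → ∀ (j : (thetaIndex (pilotDataOfK T.D T.K)).Label) (vQ : (thetaIndex (pilotDataOfK T.D T.K)).VQ),
        Set ((logShellsDH (pilotDataOfK T.D T.K) (analyticLogv T.K)).Packet j vQ))
      (thetaDiv : ℤ → ℤ → LgpDivisor M (thetaIndex (pilotDataOfK T.D T.K)).lstar)
      (n : ℤ) {HT : Type} {LogLink : HT → HT → Type} {IsFull : ∀ {s t : HT}, LogLink s t → Prop}
      (lat : LGPGaussianLogThetaLattice LogLink IsFull)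
      {Frd : Type} {IsoF : Frd → Frd → Type} {Ob : Frd → Type} {realify : Frd → Frd} {Strip : Type}
      {IsoS : Strip → Strip → Type}
      {Mv : ∀ v : (thetaIndex (pilotDataOfK T.D T.K)).V, v ∈ (thetaIndex (pilotDataOfK T.D T.K)).Vbad → Type}
      [∀ v h, Monoid (Mv v h)]
      (sig : GlobalLGPFrobenioidSignature (thetaIndex (pilotDataOfK T.D T.K)).lstar (thetaIndex (pilotDataOfK T.D T.K)).V
        (· ∈ (thetaIndex (pilotDataOfK T.D T.K)).Vbad) Frd IsoF Ob realify Strip IsoS Mv)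
      (split : SplittingMonoids Mv) {ObΔ : Type}
      {N : ∀ v : (thetaIndex (pilotDataOfK T.D T.K)).V, v ∈ (thetaIndex (pilotDataOfK T.D T.K)).Vbad → Type} [∀ v h, Monoid (N v h)]
      (qData : QPilotData ObΔ N),
      ∀ U : ImageChoice (settingPrVolSharp (pilotDataOfK T.D T.K) (logvAnalytic_analyticLogv (F := T.K)) M archPk archSub Ψ act
          Mmod region n lat sig split qData (exists_realising_qIdeles_pilotDataOfK T.D).choose
          (exists_realising_thetaIdeles_pilotDataOfK T.D).choose (exists_realising_qIdeles_pilotDataOfK T.D).choose_spec.1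
          (exists_realising_qIdeles_pilotDataOfK T.D).choose_spec.2.1),
        processionNormalized (fun i : Fin (thetaIndex (pilotDataOfK T.D T.K)).lstar =>
            ∑ᶠ vQ : (thetaIndex (pilotDataOfK T.D T.K)).VQ,
              ((LatticeSituation.ofShells (logShellsDH (pilotDataOfK T.D T.K) (analyticLogv T.K)) M archPk archSub
                  (summandPiecesPr (pilotDataOfK T.D T.K) (logvAnalytic_analyticLogv (F := T.K))).Adm
                  (summandPiecesPr (pilotDataOfK T.D T.K) (logvAnalytic_analyticLogv (F := T.K))).logvol Ψ act Mmod region frobAdm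
                  frobLogvol (fun k _ => Ψ k) frobMmod unitImage ballImage thetaDiv).D
                (settingPrVolSharp (pilotDataOfK T.D T.K) (logvAnalytic_analyticLogv (F := T.K)) M archPk archSub Ψ act Mmod region
                  n lat sig split qData (exists_realising_qIdeles_pilotDataOfK T.D).choose
                  (exists_realising_thetaIdeles_pilotDataOfK T.D).choose (exists_realising_qIdeles_pilotDataOfK T.D).choose_spec.1
                  (exists_realising_qIdeles_pilotDataOfK T.D).choose_spec.2.1).n).logvol (Setting.labelSucc i) vQ (U.1 (i, vQ))) ≤
          T.negLogThetaPerImage := by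
  intro M _ _ archPk archSub Ψ act Mmod region frobAdm frobLogvol frobMmod unitImage ballImage thetaDiv n HT LogLink IsFull lat Frd
    IsoF Ob realify Strip IsoS Mv _ sig split ObΔ N _ qData U
  letI := T.instFieldF; letI := T.instNumberFieldF; letI := T.instAlgebraF; letI := T.instFieldK
  letI := T.instNumberFieldK; letI := T.instAlgebraK; letI := T.instFieldFbar; letI := T.instAlgebraFbar
  letI := T.instAlgebraKFbar; letI := T.instIsElliptic
  exact processionNormalized_imageChoice_settingPrVolSharp_pilotDataOfK_le_genuine T.D M archPk archSub Ψ act Mmod region n lat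
    sig split qData _ _ _ _ (exists_realising_thetaIdeles_pilotDataOfK T.D).choose_spec.1
    (exists_realising_thetaIdeles_pilotDataOfK T.D).choose_spec.2.2 T.isVolumeInputOf U

end Datum

end Summit.ABC.IUTFork.Thm311.Real

end
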